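import Summits.QuantumFields.YangMills.Theorems.SmallFieldWideningLargeFieldMassRefinementTailPerFamily
import Summits.QuantumFields.YangMills.Theorems.SmallFieldWideningLargeFieldMassRefinementTailUnitTopDensity

/-!
# Route `SmallFieldWidening`, crux r3 `LargeFieldMassRefinementTail` (stmt-QuantumFields-22884), line `birth` v6 — r3 FROM PER-FAMILY UNIT-TOP TAILS
# OF THE REFINEMENTS and FROM PER-FAMILY (70)–(71)-SHAPED DENSITY RATIOS (the weakest inputs of the line, in both currencies)
# (support file; width seat `ym-line-sfw-p2-w2` gen 17; the stub `stub_firstExitDeep`, the crux and rung R3 stay OPEN)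

WHAT THIS IS NOT.  No estimate of Bałaban's programme is proved; nothing bears on the Yang–Mills mass gap; rung R3 (`YM3TorusSU2`) is a RECORD rung.
This file composes three landed supports of the line into the two weakest sufficient conditions for crux r3 recorded so far:

* `…PerFamily.largeFieldMassRefinementTail_of_firstExitFam` — r3 ⇐ the window-free deep first-exit tail FAMILY BY FAMILY (constants and depth threshold
  depending on `F, γ`);
* `…UnitTop.gibbsK_real_firstExit_eq_refine` — height `j` of run `j + d` of `F` = the unit top of run `j` of `F.refine d` at `γL^{-d}`;
* `…UnitTopDensity.gibbsK_real_unitTop_eq_integral_resUnitDensity` / `integral_resUnitDensity_univ` — the unit-top mass = `Z_K⁻¹∫_{E_q} ρ̂^{histGood K 1}_K`.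

RESULTS.
* ★ `largeFieldMassRefinementTail_of_unitTopFam` — r3 ⇐ `UnitTopFam` := for every `L` a profile `(b₀, p₀)` such that every family `F` (`F.L = L`) at every
  `γ > 0` has `n₁, N, C, c` with: for every depth `d ≥ n₁`, every run `K ≥ 2` of the REFINED family `F.refine d` at coupling `γL^{-d}` and every unit plaquette `p`,
  `Gibbs^{F.refine d}_K{ sub-unit history θ_{b₀}-small ∧ θ_{b₀}(0) ≤ |Ū^K(∂p) − 1| } ≤ C·(γL^{-d})^{-N}·exp(−c·p_{b₀}(√(γL^{-d}))²)`
  («the unit-top tails of the deep refinements of ONE family»).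
* ★ `largeFieldMassRefinementTail_of_densityRatioFam` — r3 ⇐ the same with each unit-top mass replaced by Bałaban's density ratio
  `∫_{θ_{b₀}(0) ≤ |u(∂q)−1|} ρ̂^{histGood K 1}_K du ≤ C·(γL^{-d})^{-N}·e^{−c p²}·∫ρ̂^{univ}_K du` for the refined families — the EXACT minimal target of a
  density-level ((α)/small-field) supplier for THIS crux: one family's refinements, eventually in the depth, constants free to depend on `(F, γ)`.
Compare the shared stub `stub_firstExitDeep` ⟺ `UnitTop` (companion file): the same inequality for ALL families and ALL `γ ≤ γ₁` with ONE set of constants.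

References: T. Bałaban, Commun. Math. Phys. **102** (1985) 255–275 [Balaban1985UV3] ((1)–(3) p.256, (7) p.257, (41) p.266, (70)–(71) p.273).
-/

noncomputable section

open MeasureTheory Filter Topology
open Literature.MathematicalPhysics.QuantumFieldTheory.Balaban1983to89
open Literature.MathematicalPhysics.QuantumFieldTheory.Balaban1983to89.Missing
open Literature.MathematicalPhysics.QuantumFieldTheory.Balaban1983to89.T3ContinuumYM3Torus
open Literature.MathematicalPhysics.QuantumFieldTheory.Balaban1983to89.T3UnitScaleTilt
open Literature.MathematicalPhysics.QuantumFieldTheory.Balaban1983to89.T3UnitLawDensityEML (ℰp measurableE_ℰp)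
open Literature.MathematicalPhysics.QuantumFieldTheory.Balaban1983to89.T3LevelShift
open Literature.MathematicalPhysics.QuantumFieldTheory.Balaban1983to89.T3RestrictedUnitDensity
open Summit.QuantumFields.YangMills.Theorems.LargeFieldMassRefinementTailUnitTop (gibbsK_real_firstExit_eq_refine)
open Summit.QuantumFields.YangMills.Theorems.LargeFieldMassRefinementTailUnitTopDensity
  (gibbsK_real_unitTop_eq_integral_resUnitDensity integral_resUnitDensity_univ)
open Summit.QuantumFields.YangMills.Theorems.LargeFieldMassRefinementTailPerFamily (largeFieldMassRefinementTail_of_firstExitFam)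

namespace Summit.QuantumFields.YangMills.Theorems.LargeFieldMassRefinementTailPerFamilyUnitTop

/-- ★ **r3 ⇐ THE UNIT-TOP TAILS OF THE DEEP REFINEMENTS OF EACH FAMILY** (constants and depth threshold depending on the family and the coupling): the
height-`j` first-exit event of run `K = j + d` of `F` is the unit-top event of run `j` of `F.refine d` (`gibbsK_real_firstExit_eq_refine`), so `UnitTopFam` is
`FirstExitFam` of the companion file read through the level shift.  Conditional certificate; nothing about the mass gap. [cite: Balaban1985UV3, (7) p.257 and (71) p.273] -/
theorem largeFieldMassRefinementTail_of_unitTopFam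
    (hU : ∀ L : ℕ, ∃ (b₀ p₀ : ℝ), 0 < b₀ ∧ 2 < p₀ ∧ ∀ (F : T3Family) (γ : ℝ), F.L = L → 0 < γ →
      ∃ (n₁ N : ℕ) (C c : ℝ), 0 < c ∧ ∀ d : ℕ, n₁ ≤ d → ∀ K : ℕ, 2 ≤ K → ∀ p : Plaq ((F.refine d).P K) K,
        (gibbsK (F.refine d) ℰp (γ * ((F.L : ℝ)⁻¹) ^ d) K).real
            {V | (∀ k, k < K → PlaqSmall (θBal F.L (γ * ((F.L : ℝ)⁻¹) ^ d) b₀ p₀ (K - k))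
                (Averaging.iter (fun i => BlockAveraging.blockAvg (P := (F.refine d).P K) (j := i) ℰp) k V)) ∧
              θBal F.L (γ * ((F.L : ℝ)⁻¹) ^ d) b₀ p₀ 0 ≤ GaugeGroup.dist1 (GaugeField.plaqHol
                (Averaging.iter (fun i => BlockAveraging.blockAvg (P := (F.refine d).P K) (j := i) ℰp) K V) p)} ≤
          C * ((γ * ((F.L : ℝ)⁻¹) ^ d)⁻¹) ^ N *
            Real.exp (-(c * B10.pFun b₀ p₀ (Real.sqrt (γ * ((F.L : ℝ)⁻¹) ^ d)) ^ 2))) :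
    Summit.QuantumFields.YangMills.Theses.SmallFieldWidening.LargeFieldMassRefinementTail := by
  refine largeFieldMassRefinementTail_of_firstExitFam fun L => ?_
  obtain ⟨b₀, p₀, hb₀, hp₀, hU⟩ := hU L
  refine ⟨b₀, p₀, hb₀, hp₀, fun F γ hFL hγ => ?_⟩
  obtain ⟨n₁, N, C, c, hc, h⟩ := hU F γ hFL hγ
  refine ⟨n₁, N, C, c, hc, fun K j hj hjK p => ?_⟩
  -- `K = j + d`, `d ≥ n₁`
  obtain ⟨d, rfl⟩ := Nat.exists_eq_add_of_le (show j ≤ K by omega)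
  have hd : n₁ ≤ d := by omega
  have happ := h d hd j hj
    (plaqShift (F.sitesPerDir_eq (m := F.m) (K := j + d) (j := j) (m' := F.m + d) (K' := j) (j' := j) (by omega)) p)
  rw [← gibbsK_real_firstExit_eq_refine F γ hγ.le b₀ p₀ d j p] at happ
  rw [show j + d - j = d from Nat.add_sub_cancel_left j d]
  exact happ

/-- ★ **r3 ⇐ PER-FAMILY (70)–(71)-SHAPED DENSITY RATIOS FOR THE DEEP REFINEMENTS**: if for every block size `L` there is a profile `(b₀, p₀)` such that every
family `F` (`F.L = L`) at every `γ > 0` has `n₁, N, C, c` with, for every depth `d ≥ n₁`, every run `K ≥ 2` of `F.refine d` at `γ_d = γL^{-d}` and every unit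
plaquette label `q`, `∫_{θ_{b₀}(0) ≤ |u(∂q) − 1|} ρ̂^{histGood K 1}_K du ≤ C·γ_d^{-N}·exp(−c·p_{b₀}(√γ_d)²)·∫ ρ̂^{univ}_K du` (Bałaban's terminal restricted densities
of the refined family, `T3RestrictedUnitDensity.resUnitDensity`), then crux r3 holds.  The weakest density-level input for stmt-QuantumFields-22884 on record.
Conditional certificate; nothing about the mass gap. [cite: Balaban1985UV3, (41) p.266 and (70)-(71) p.273] -/
theorem largeFieldMassRefinementTail_of_densityRatioFam
    (hR : ∀ L : ℕ, ∃ (b₀ p₀ : ℝ), 0 < b₀ ∧ 2 < p₀ ∧ ∀ (F : T3Family) (γ : ℝ), F.L = L → 0 < γ →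
      ∃ (n₁ N : ℕ) (C c : ℝ), 0 < c ∧ ∀ d : ℕ, n₁ ≤ d → ∀ K : ℕ, 2 ≤ K → ∀ q : Plaq ((F.refine d).P 0) 0,
        ∫ u in {u | θBal F.L (γ * ((F.L : ℝ)⁻¹) ^ d) b₀ p₀ 0 ≤ GaugeGroup.dist1 (GaugeField.plaqHol u q)},
            resUnitDensity (F.refine d) (γ * ((F.L : ℝ)⁻¹) ^ d) K
              (histGood (F.refine d) ℰp (θBal F.L (γ * ((F.L : ℝ)⁻¹) ^ d) b₀ p₀) K 1) u
            ∂fieldMeasure ((F.refine d).P 0) 0 (Matrix.specialUnitaryGroup (Fin 2) ℂ) ≤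
          C * ((γ * ((F.L : ℝ)⁻¹) ^ d)⁻¹) ^ N * Real.exp (-(c * B10.pFun b₀ p₀ (Real.sqrt (γ * ((F.L : ℝ)⁻¹) ^ d)) ^ 2)) *
            ∫ u, resUnitDensity (F.refine d) (γ * ((F.L : ℝ)⁻¹) ^ d) K Set.univ u
              ∂fieldMeasure ((F.refine d).P 0) 0 (Matrix.specialUnitaryGroup (Fin 2) ℂ)) :
    Summit.QuantumFields.YangMills.Theses.SmallFieldWidening.LargeFieldMassRefinementTail := by
  refine largeFieldMassRefinementTail_of_unitTopFam fun L => ?_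
  obtain ⟨b₀, p₀, hb₀, hp₀, hR⟩ := hR L
  refine ⟨b₀, p₀, hb₀, hp₀, fun F γ hFL hγ => ?_⟩
  obtain ⟨n₁, N, C, c, hc, h⟩ := hR F γ hFL hγ
  refine ⟨n₁, N, C, c, hc, fun d hd K hK p => ?_⟩
  have hγd : 0 < γ * ((F.L : ℝ)⁻¹) ^ d :=
    mul_pos hγ (pow_pos (inv_pos.mpr (by exact_mod_cast (zero_lt_one.trans F.hL.2))) d)
  have hZ : 0 < partitionFn (G := Matrix.specialUnitaryGroup (Fin 2) ℂ) ((F.refine d).P K)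
      (((F.refine d).scheme ℰp (γ * ((F.L : ℝ)⁻¹) ^ d)).β K) :=
    partitionFn_pos' _ ((F.refine d).scheme_β_nonneg ℰp hγd.le K)
  have happ := h d hd K hK ((plaqShift ((F.refine d).sitesPerDir_unit K)).symm p)
  rw [integral_resUnitDensity_univ (F.refine d) K hγd.le] at happ
  have key := gibbsK_real_unitTop_eq_integral_resUnitDensity (F.refine d) K hγd.le
    (θBal F.L (γ * ((F.L : ℝ)⁻¹) ^ d) b₀ p₀) (θBal F.L (γ * ((F.L : ℝ)⁻¹) ^ d) b₀ p₀ 0) p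
  rw [key, inv_mul_le_iff₀ hZ]
  calc _ ≤ _ := happ
    _ = _ := by ring

end Summit.QuantumFields.YangMills.Theorems.LargeFieldMassRefinementTailPerFamilyUnitTop

end
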